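import Summits.Ventures.PercRepro.Night2ShapeOneSigma

/-!
# PercRepro — the seven-point shape (i): PER-SIDE bounds of the column bound, part B (night-2, gen 30)

ONE SIDE = one line with its three sources and three `K`-faces (the face of `ℓ₁` at `p` has closure `K_p` and is shared by
the two sources `≠ p`).  The outside points VISIBLE on the side are those off at least one of its three closures; a visible
point in `H` is free (in no `K_p`) or attached to one `p`, a visible point off `H` likewise and it is GOOD for every source
of the side (Night2ShapeOneSigma, proofs/NIGHT-2-g30.md §3).  With the counts `fE` (free, in `H`), `a_p` (attached, in `H`),
`zf` (free, off `H`), `z_p` (attached, off `H`): `s_p = fE + zf + (a_c + z_c) + (a_d + z_d)` visible points off `K_p`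
(`m(K_p) = 2 + s_p`) and `g_p = 1 + fE + a_p + zf + (z₁ + z₂ + z₃)` good points of the source `p`.  The CORE lemmas take the
three losses `L_q` abstractly with their three properties (`lossHF_props`): nonnegative, `≤ sigHF s_c + sigHF s_d`, and
vanishing when a face of the source is null.  This part: **B7** (`fE ≥ 2`: `≤ 50/720`), **B3** (`fE ≥ 2` and a visible `Z`-point: `≤ 7/288`), **B8** (`fE ≥ 1`, `N ≥ 2`: `≤ 71/540`), **B10′** (all points attached to one face: `≤ 53/720`) and **B5′** (a visible `Z`-point and `N ≥ 3`: `≤ 23/144`).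
-/

namespace PercRepro.Shadow

section Side

variable {fE a₁ a₂ a₃ zf z₁ z₂ z₃ s₁ s₂ s₃ g₁ g₂ g₃ : ℕ} {L₁ L₂ L₃ : ℚ}

/-- **B7 (core).** Two free `E`-points (`fE ≥ 2`): the load is at most `50/720`. -/
theorem sideHF_core_fE2
    (hs₁ : s₁ = fE + zf + (a₂ + z₂) + (a₃ + z₃)) (hs₂ : s₂ = fE + zf + (a₁ + z₁) + (a₃ + z₃))
    (hs₃ : s₃ = fE + zf + (a₁ + z₁) + (a₂ + z₂))
    (hg₁ : g₁ = 1 + fE + a₁ + zf + (z₁ + z₂ + z₃)) (hg₂ : g₂ = 1 + fE + a₂ + zf + (z₁ + z₂ + z₃))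
    (hg₃ : g₃ = 1 + fE + a₃ + zf + (z₁ + z₂ + z₃))
    (hL₁ : 0 ≤ L₁) (hB₁ : L₁ ≤ sigHF s₂ + sigHF s₃) (_hn₁ : s₂ = 0 ∨ s₃ = 0 → L₁ = 0)
    (hL₂ : 0 ≤ L₂) (hB₂ : L₂ ≤ sigHF s₁ + sigHF s₃) (_hn₂ : s₁ = 0 ∨ s₃ = 0 → L₂ = 0)
    (hL₃ : 0 ≤ L₃) (hB₃ : L₃ ≤ sigHF s₁ + sigHF s₂) (_hn₃ : s₁ = 0 ∨ s₂ = 0 → L₃ = 0)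
    (hf : 2 ≤ fE) :
    L₁ / (g₁ : ℚ) + L₂ / (g₂ : ℚ) + L₃ / (g₃ : ℚ) ≤ 50 / 720 := by
  have hσ₁ := sigHF_nonneg s₁
  have hσ₂ := sigHF_nonneg s₂
  have hσ₃ := sigHF_nonneg s₃
  have hσ₁' := sigHF_le_one s₁
  have hσ₂' := sigHF_le_one s₂
  have hσ₃' := sigHF_le_one s₃
  have e₁ := sigHF_le_two (s := s₁) (by omega)
  have e₂ := sigHF_le_two (s := s₂) (by omega)
  have e₃ := sigHF_le_two (s := s₃) (by omega)
  have t₁ := div_nat_le_div_of_le hL₁ (hB₁.trans (by linarith : sigHF s₂ + sigHF s₃ ≤ 50 / 720)) (g := g₁) (k := 3) (by norm_num) (by omega)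
  have t₂ := div_nat_le_div_of_le hL₂ (hB₂.trans (by linarith : sigHF s₁ + sigHF s₃ ≤ 50 / 720)) (g := g₂) (k := 3) (by norm_num) (by omega)
  have t₃ := div_nat_le_div_of_le hL₃ (hB₃.trans (by linarith : sigHF s₁ + sigHF s₂ ≤ 50 / 720)) (g := g₃) (k := 3) (by norm_num) (by omega)
  norm_num at t₁ t₂ t₃
  linarith

set_option maxHeartbeats 800000 in
/-- **B3 (core).** Two free `E`-points and a visible `Z`-point: the load is at most `17.5/720 = 7/288`. -/
theorem sideHF_core_fE2_zeta
    (hs₁ : s₁ = fE + zf + (a₂ + z₂) + (a₃ + z₃)) (hs₂ : s₂ = fE + zf + (a₁ + z₁) + (a₃ + z₃))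
    (hs₃ : s₃ = fE + zf + (a₁ + z₁) + (a₂ + z₂))
    (hg₁ : g₁ = 1 + fE + a₁ + zf + (z₁ + z₂ + z₃)) (hg₂ : g₂ = 1 + fE + a₂ + zf + (z₁ + z₂ + z₃))
    (hg₃ : g₃ = 1 + fE + a₃ + zf + (z₁ + z₂ + z₃))
    (hL₁ : 0 ≤ L₁) (hB₁ : L₁ ≤ sigHF s₂ + sigHF s₃) (_hn₁ : s₂ = 0 ∨ s₃ = 0 → L₁ = 0)
    (hL₂ : 0 ≤ L₂) (hB₂ : L₂ ≤ sigHF s₁ + sigHF s₃) (_hn₂ : s₁ = 0 ∨ s₃ = 0 → L₂ = 0)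
    (hL₃ : 0 ≤ L₃) (hB₃ : L₃ ≤ sigHF s₁ + sigHF s₂) (_hn₃ : s₁ = 0 ∨ s₂ = 0 → L₃ = 0)
    (hf : 2 ≤ fE) (hζ : 1 ≤ zf + (z₁ + z₂ + z₃)) :
    L₁ / (g₁ : ℚ) + L₂ / (g₂ : ℚ) + L₃ / (g₃ : ℚ) ≤ 7 / 288 := by
  have hσ₁ := sigHF_nonneg s₁
  have hσ₂ := sigHF_nonneg s₂
  have hσ₃ := sigHF_nonneg s₃
  have hσ₁' := sigHF_le_one s₁
  have hσ₂' := sigHF_le_one s₂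
  have hσ₃' := sigHF_le_one s₃
  have hg₁4 : 4 ≤ g₁ := by omega
  have hg₂4 : 4 ≤ g₂ := by omega
  have hg₃4 : 4 ≤ g₃ := by omega
  by_cases h3 : 3 ≤ fE + zf
  · -- every `s ≥ 3`
    have e₁ := sigHF_le_three (s := s₁) (by omega)
    have e₂ := sigHF_le_three (s := s₂) (by omega)
    have e₃ := sigHF_le_three (s := s₃) (by omega)
    have t₁ := div_nat_le_div_of_le hL₁ (hB₁.trans (by linarith : sigHF s₂ + sigHF s₃ ≤ 10 / 720)) (g := g₁) (k := 4) (by norm_num) hg₁4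
    have t₂ := div_nat_le_div_of_le hL₂ (hB₂.trans (by linarith : sigHF s₁ + sigHF s₃ ≤ 10 / 720)) (g := g₂) (k := 4) (by norm_num) hg₂4
    have t₃ := div_nat_le_div_of_le hL₃ (hB₃.trans (by linarith : sigHF s₁ + sigHF s₂ ≤ 10 / 720)) (g := g₃) (k := 4) (by norm_num) hg₃4
    norm_num at t₁ t₂ t₃
    linarith
  · -- `fE = 2`, `zf = 0`: the `Z`-point is attached to some `p`, the two other faces have `s ≥ 3`
    have key : ∀ (tp tc td : ℚ), tp ≤ 10 / 720 / 4 → tc ≤ 30 / 720 / 4 → td ≤ 30 / 720 / 4 → tp + tc + td ≤ 7 / 288 := by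
      intros; linarith
    have e₁ := sigHF_le_two (s := s₁) (by omega)
    have e₂ := sigHF_le_two (s := s₂) (by omega)
    have e₃ := sigHF_le_two (s := s₃) (by omega)
    rcases Nat.eq_zero_or_pos z₁ with h1 | h1
    · rcases Nat.eq_zero_or_pos z₂ with h2 | h2
      · have h3' : 0 < z₃ := by omega
        have f₁ := sigHF_le_three (s := s₁) (by omega)
        have f₂ := sigHF_le_three (s := s₂) (by omega)
        have t₃ := div_nat_le_div_of_le hL₃ (hB₃.trans (by linarith : sigHF s₁ + sigHF s₂ ≤ 10 / 720)) (g := g₃) (k := 4) (by norm_num) hg₃4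
        have t₁ := div_nat_le_div_of_le hL₁ (hB₁.trans (by linarith : sigHF s₂ + sigHF s₃ ≤ 30 / 720)) (g := g₁) (k := 4) (by norm_num) hg₁4
        have t₂ := div_nat_le_div_of_le hL₂ (hB₂.trans (by linarith : sigHF s₁ + sigHF s₃ ≤ 30 / 720)) (g := g₂) (k := 4) (by norm_num) hg₂4
        have := key _ _ _ t₃ t₁ t₂; linarith
      · have f₁ := sigHF_le_three (s := s₁) (by omega)
        have f₃ := sigHF_le_three (s := s₃) (by omega)
        have t₂ := div_nat_le_div_of_le hL₂ (hB₂.trans (by linarith : sigHF s₁ + sigHF s₃ ≤ 10 / 720)) (g := g₂) (k := 4) (by norm_num) hg₂4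
        have t₁ := div_nat_le_div_of_le hL₁ (hB₁.trans (by linarith : sigHF s₂ + sigHF s₃ ≤ 30 / 720)) (g := g₁) (k := 4) (by norm_num) hg₁4
        have t₃ := div_nat_le_div_of_le hL₃ (hB₃.trans (by linarith : sigHF s₁ + sigHF s₂ ≤ 30 / 720)) (g := g₃) (k := 4) (by norm_num) hg₃4
        have := key _ _ _ t₂ t₁ t₃; linarith
    · have f₂ := sigHF_le_three (s := s₂) (by omega)
      have f₃ := sigHF_le_three (s := s₃) (by omega)
      have t₁ := div_nat_le_div_of_le hL₁ (hB₁.trans (by linarith : sigHF s₂ + sigHF s₃ ≤ 10 / 720)) (g := g₁) (k := 4) (by norm_num) hg₁4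
      have t₂ := div_nat_le_div_of_le hL₂ (hB₂.trans (by linarith : sigHF s₁ + sigHF s₃ ≤ 30 / 720)) (g := g₂) (k := 4) (by norm_num) hg₂4
      have t₃ := div_nat_le_div_of_le hL₃ (hB₃.trans (by linarith : sigHF s₁ + sigHF s₂ ≤ 30 / 720)) (g := g₃) (k := 4) (by norm_num) hg₃4
      have := key _ _ _ t₁ t₂ t₃; linarith

set_option maxHeartbeats 800000 in
/-- **B8 (core).** A free `E`-point and at least two visible points: the load is at most `94.67/720 = 71/540`. -/
theorem sideHF_core_fE1_N2
    (hs₁ : s₁ = fE + zf + (a₂ + z₂) + (a₃ + z₃)) (hs₂ : s₂ = fE + zf + (a₁ + z₁) + (a₃ + z₃))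
    (hs₃ : s₃ = fE + zf + (a₁ + z₁) + (a₂ + z₂))
    (hg₁ : g₁ = 1 + fE + a₁ + zf + (z₁ + z₂ + z₃)) (hg₂ : g₂ = 1 + fE + a₂ + zf + (z₁ + z₂ + z₃))
    (hg₃ : g₃ = 1 + fE + a₃ + zf + (z₁ + z₂ + z₃))
    (hL₁ : 0 ≤ L₁) (hB₁ : L₁ ≤ sigHF s₂ + sigHF s₃) (_hn₁ : s₂ = 0 ∨ s₃ = 0 → L₁ = 0)
    (hL₂ : 0 ≤ L₂) (hB₂ : L₂ ≤ sigHF s₁ + sigHF s₃) (_hn₂ : s₁ = 0 ∨ s₃ = 0 → L₂ = 0)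
    (hL₃ : 0 ≤ L₃) (hB₃ : L₃ ≤ sigHF s₁ + sigHF s₂) (_hn₃ : s₁ = 0 ∨ s₂ = 0 → L₃ = 0)
    (hf : 1 ≤ fE) (hN : 2 ≤ fE + zf + (a₁ + z₁) + (a₂ + z₂) + (a₃ + z₃)) :
    L₁ / (g₁ : ℚ) + L₂ / (g₂ : ℚ) + L₃ / (g₃ : ℚ) ≤ 71 / 540 := by
  have hσ₁ := sigHF_nonneg s₁
  have hσ₂ := sigHF_nonneg s₂
  have hσ₃ := sigHF_nonneg s₃
  have hσ₁' := sigHF_le_one s₁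
  have hσ₂' := sigHF_le_one s₂
  have hσ₃' := sigHF_le_one s₃
  have hg₁2 : 2 ≤ g₁ := by omega
  have hg₂2 : 2 ≤ g₂ := by omega
  have hg₃2 : 2 ≤ g₃ := by omega
  by_cases h2 : 2 ≤ fE + zf
  · have e₁ := sigHF_le_two (s := s₁) (by omega)
    have e₂ := sigHF_le_two (s := s₂) (by omega)
    have e₃ := sigHF_le_two (s := s₃) (by omega)
    have t₁ := div_nat_le_div_of_le hL₁ (hB₁.trans (by linarith : sigHF s₂ + sigHF s₃ ≤ 50 / 720)) (g := g₁) (k := 3) (by norm_num) (by omega)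
    have t₂ := div_nat_le_div_of_le hL₂ (hB₂.trans (by linarith : sigHF s₁ + sigHF s₃ ≤ 50 / 720)) (g := g₂) (k := 3) (by norm_num) (by omega)
    have t₃ := div_nat_le_div_of_le hL₃ (hB₃.trans (by linarith : sigHF s₁ + sigHF s₂ ≤ 50 / 720)) (g := g₃) (k := 3) (by norm_num) (by omega)
    norm_num at t₁ t₂ t₃
    linarith
  · -- `fE = 1`, `zf = 0`, some `n_p ≥ 1`
    have key : ∀ (tp tc td : ℚ), tp ≤ 50 / 720 / 3 → tc ≤ 78 / 720 / 2 → td ≤ 78 / 720 / 2 → tp + tc + td ≤ 71 / 540 := by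
      intros; linarith
    rcases Nat.eq_zero_or_pos (a₁ + z₁) with h1 | h1
    · rcases Nat.eq_zero_or_pos (a₂ + z₂) with h2' | h2'
      · have e₁ := sigHF_le_two (s := s₁) (by omega)
        have e₂ := sigHF_le_two (s := s₂) (by omega)
        have t₃ := div_nat_le_div_of_le hL₃ (hB₃.trans (by linarith : sigHF s₁ + sigHF s₂ ≤ 50 / 720)) (g := g₃) (k := 3) (by norm_num) (by omega)
        have t₁ := div_nat_le_div_of_le hL₁ (hB₁.trans (by linarith : sigHF s₂ + sigHF s₃ ≤ 78 / 720)) (g := g₁) (k := 2) (by norm_num) hg₁2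
        have t₂ := div_nat_le_div_of_le hL₂ (hB₂.trans (by linarith : sigHF s₁ + sigHF s₃ ≤ 78 / 720)) (g := g₂) (k := 2) (by norm_num) hg₂2
        have := key _ _ _ t₃ t₁ t₂; linarith
      · have e₁ := sigHF_le_two (s := s₁) (by omega)
        have e₃ := sigHF_le_two (s := s₃) (by omega)
        have t₂ := div_nat_le_div_of_le hL₂ (hB₂.trans (by linarith : sigHF s₁ + sigHF s₃ ≤ 50 / 720)) (g := g₂) (k := 3) (by norm_num) (by omega)
        have t₁ := div_nat_le_div_of_le hL₁ (hB₁.trans (by linarith : sigHF s₂ + sigHF s₃ ≤ 78 / 720)) (g := g₁) (k := 2) (by norm_num) hg₁2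
        have t₃ := div_nat_le_div_of_le hL₃ (hB₃.trans (by linarith : sigHF s₁ + sigHF s₂ ≤ 78 / 720)) (g := g₃) (k := 2) (by norm_num) hg₃2
        have := key _ _ _ t₂ t₁ t₃; linarith
    · have e₂ := sigHF_le_two (s := s₂) (by omega)
      have e₃ := sigHF_le_two (s := s₃) (by omega)
      have t₁ := div_nat_le_div_of_le hL₁ (hB₁.trans (by linarith : sigHF s₂ + sigHF s₃ ≤ 50 / 720)) (g := g₁) (k := 3) (by norm_num) (by omega)
      have t₂ := div_nat_le_div_of_le hL₂ (hB₂.trans (by linarith : sigHF s₁ + sigHF s₃ ≤ 78 / 720)) (g := g₂) (k := 2) (by norm_num) hg₂2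
      have t₃ := div_nat_le_div_of_le hL₃ (hB₃.trans (by linarith : sigHF s₁ + sigHF s₂ ≤ 78 / 720)) (g := g₃) (k := 2) (by norm_num) hg₃2
      have := key _ _ _ t₁ t₂ t₃; linarith

/-- **B10′ (core).** No free point, no visible `Z`-point, every attached point on the same face `1`: only the source `1`
loads, at most `53/720`. -/
theorem sideHF_core_null₁
    (hs₁ : s₁ = fE + zf + (a₂ + z₂) + (a₃ + z₃)) (hs₂ : s₂ = fE + zf + (a₁ + z₁) + (a₃ + z₃))
    (hs₃ : s₃ = fE + zf + (a₁ + z₁) + (a₂ + z₂))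
    (hg₁ : g₁ = 1 + fE + a₁ + zf + (z₁ + z₂ + z₃)) (hg₂ : g₂ = 1 + fE + a₂ + zf + (z₁ + z₂ + z₃))
    (hg₃ : g₃ = 1 + fE + a₃ + zf + (z₁ + z₂ + z₃))
    (hL₁ : 0 ≤ L₁) (hB₁ : L₁ ≤ sigHF s₂ + sigHF s₃) (_hn₁ : s₂ = 0 ∨ s₃ = 0 → L₁ = 0)
    (_hL₂ : 0 ≤ L₂) (_hB₂ : L₂ ≤ sigHF s₁ + sigHF s₃) (hn₂ : s₁ = 0 ∨ s₃ = 0 → L₂ = 0)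
    (_hL₃ : 0 ≤ L₃) (_hB₃ : L₃ ≤ sigHF s₁ + sigHF s₂) (hn₃ : s₁ = 0 ∨ s₂ = 0 → L₃ = 0)
    (hfE : fE = 0) (hζ : zf + (z₁ + z₂ + z₃) = 0) (h2 : a₂ = 0) (h3 : a₃ = 0) :
    L₁ / (g₁ : ℚ) + L₂ / (g₂ : ℚ) + L₃ / (g₃ : ℚ) ≤ 53 / 720 := by
  have hs₁0 : s₁ = 0 := by omega
  rw [hn₂ (Or.inl hs₁0), hn₃ (Or.inl hs₁0), zero_div_nat, zero_div_nat]
  have hs₂' : s₂ = a₁ := by omega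
  have hs₃' : s₃ = a₁ := by omega
  have t₁ := div_nat_le_div_of_le hL₁ (hB₁.trans (by rw [hs₂', hs₃']; linarith : sigHF s₂ + sigHF s₃ ≤ 2 * sigHF a₁))
    (g := g₁) (k := 1 + a₁) (by omega) (by omega)
  have := two_sigHF_div_le a₁
  linarith


/-- **B10′ (core), face `2`.** -/
theorem sideHF_core_null₂
    (hs₁ : s₁ = fE + zf + (a₂ + z₂) + (a₃ + z₃)) (hs₂ : s₂ = fE + zf + (a₁ + z₁) + (a₃ + z₃))
    (hs₃ : s₃ = fE + zf + (a₁ + z₁) + (a₂ + z₂))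
    (hg₁ : g₁ = 1 + fE + a₁ + zf + (z₁ + z₂ + z₃)) (hg₂ : g₂ = 1 + fE + a₂ + zf + (z₁ + z₂ + z₃))
    (hg₃ : g₃ = 1 + fE + a₃ + zf + (z₁ + z₂ + z₃))
    (hL₁ : 0 ≤ L₁) (hB₁ : L₁ ≤ sigHF s₂ + sigHF s₃) (hn₁ : s₂ = 0 ∨ s₃ = 0 → L₁ = 0)
    (hL₂ : 0 ≤ L₂) (hB₂ : L₂ ≤ sigHF s₁ + sigHF s₃) (hn₂ : s₁ = 0 ∨ s₃ = 0 → L₂ = 0)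
    (hL₃ : 0 ≤ L₃) (hB₃ : L₃ ≤ sigHF s₁ + sigHF s₂) (hn₃ : s₁ = 0 ∨ s₂ = 0 → L₃ = 0)
    (hfE : fE = 0) (hζ : zf + (z₁ + z₂ + z₃) = 0) (h1 : a₁ = 0) (h3 : a₃ = 0) :
    L₁ / (g₁ : ℚ) + L₂ / (g₂ : ℚ) + L₃ / (g₃ : ℚ) ≤ 53 / 720 := by
  have h := sideHF_core_null₁ (fE := fE) (a₁ := a₂) (a₂ := a₁) (a₃ := a₃) (zf := zf) (z₁ := z₂) (z₂ := z₁) (z₃ := z₃)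
    (s₁ := s₂) (s₂ := s₁) (s₃ := s₃) (g₁ := g₂) (g₂ := g₁) (g₃ := g₃) (L₁ := L₂) (L₂ := L₁) (L₃ := L₃)
    (by omega) (by omega) (by omega) (by omega) (by omega) (by omega) hL₂ hB₂ hn₂ hL₁ hB₁ hn₁ hL₃ (by linarith)
    (fun h => hn₃ h.symm) hfE (by omega) h1 h3
  linarith

/-- **B10′ (core), face `3`.** -/
theorem sideHF_core_null₃
    (hs₁ : s₁ = fE + zf + (a₂ + z₂) + (a₃ + z₃)) (hs₂ : s₂ = fE + zf + (a₁ + z₁) + (a₃ + z₃))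
    (hs₃ : s₃ = fE + zf + (a₁ + z₁) + (a₂ + z₂))
    (hg₁ : g₁ = 1 + fE + a₁ + zf + (z₁ + z₂ + z₃)) (hg₂ : g₂ = 1 + fE + a₂ + zf + (z₁ + z₂ + z₃))
    (hg₃ : g₃ = 1 + fE + a₃ + zf + (z₁ + z₂ + z₃))
    (hL₁ : 0 ≤ L₁) (hB₁ : L₁ ≤ sigHF s₂ + sigHF s₃) (hn₁ : s₂ = 0 ∨ s₃ = 0 → L₁ = 0)
    (hL₂ : 0 ≤ L₂) (hB₂ : L₂ ≤ sigHF s₁ + sigHF s₃) (hn₂ : s₁ = 0 ∨ s₃ = 0 → L₂ = 0)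
    (hL₃ : 0 ≤ L₃) (hB₃ : L₃ ≤ sigHF s₁ + sigHF s₂) (hn₃ : s₁ = 0 ∨ s₂ = 0 → L₃ = 0)
    (hfE : fE = 0) (hζ : zf + (z₁ + z₂ + z₃) = 0) (h1 : a₁ = 0) (h2 : a₂ = 0) :
    L₁ / (g₁ : ℚ) + L₂ / (g₂ : ℚ) + L₃ / (g₃ : ℚ) ≤ 53 / 720 := by
  have h := sideHF_core_null₁ (fE := fE) (a₁ := a₃) (a₂ := a₂) (a₃ := a₁) (zf := zf) (z₁ := z₃) (z₂ := z₂) (z₃ := z₁)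
    (s₁ := s₃) (s₂ := s₂) (s₃ := s₁) (g₁ := g₃) (g₂ := g₂) (g₃ := g₁) (L₁ := L₃) (L₂ := L₂) (L₃ := L₁)
    (by omega) (by omega) (by omega) (by omega) (by omega) (by omega) hL₃ (by linarith) (fun h => hn₃ h.symm)
    hL₂ (by linarith) (fun h => hn₂ h.symm) hL₁ (by linarith) (fun h => hn₁ h.symm) hfE (by omega) h2 h1
  linarith

set_option maxHeartbeats 1600000 in
/-- **B5′ (core).** A visible `Z`-point and at least three visible points: the load is at most `115/720 = 23/144`. -/
theorem sideHF_core_zeta_N3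
    (hs₁ : s₁ = fE + zf + (a₂ + z₂) + (a₃ + z₃)) (hs₂ : s₂ = fE + zf + (a₁ + z₁) + (a₃ + z₃))
    (hs₃ : s₃ = fE + zf + (a₁ + z₁) + (a₂ + z₂))
    (hg₁ : g₁ = 1 + fE + a₁ + zf + (z₁ + z₂ + z₃)) (hg₂ : g₂ = 1 + fE + a₂ + zf + (z₁ + z₂ + z₃))
    (hg₃ : g₃ = 1 + fE + a₃ + zf + (z₁ + z₂ + z₃))
    (hL₁ : 0 ≤ L₁) (hB₁ : L₁ ≤ sigHF s₂ + sigHF s₃) (hn₁ : s₂ = 0 ∨ s₃ = 0 → L₁ = 0)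
    (hL₂ : 0 ≤ L₂) (hB₂ : L₂ ≤ sigHF s₁ + sigHF s₃) (hn₂ : s₁ = 0 ∨ s₃ = 0 → L₂ = 0)
    (hL₃ : 0 ≤ L₃) (hB₃ : L₃ ≤ sigHF s₁ + sigHF s₂) (hn₃ : s₁ = 0 ∨ s₂ = 0 → L₃ = 0)
    (hζ : 1 ≤ zf + (z₁ + z₂ + z₃)) (hN : 3 ≤ fE + zf + (a₁ + z₁) + (a₂ + z₂) + (a₃ + z₃)) :
    L₁ / (g₁ : ℚ) + L₂ / (g₂ : ℚ) + L₃ / (g₃ : ℚ) ≤ 23 / 144 := by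
  have hσ₁ := sigHF_nonneg s₁
  have hσ₂ := sigHF_nonneg s₂
  have hσ₃ := sigHF_nonneg s₃
  have hσ₁' := sigHF_le_one s₁
  have hσ₂' := sigHF_le_one s₂
  have hσ₃' := sigHF_le_one s₃
  have hg₁2 : 2 ≤ g₁ := by omega
  have hg₂2 : 2 ≤ g₂ := by omega
  have hg₃2 : 2 ≤ g₃ := by omega
  have key : ∀ (tp tc td : ℚ) (bp bc bd : ℚ), tp ≤ bp → tc ≤ bc → td ≤ bd → bp + bc + bd ≤ 23 / 144 →
      tp + tc + td ≤ 23 / 144 := by intros; linarith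
  rcases Nat.lt_or_ge (fE + zf) 2 with hf | hf
  swap
  · have e₁ := sigHF_le_two (s := s₁) (by omega)
    have e₂ := sigHF_le_two (s := s₂) (by omega)
    have e₃ := sigHF_le_two (s := s₃) (by omega)
    have t₁ := div_nat_le_div_of_le hL₁ (hB₁.trans (by linarith : sigHF s₂ + sigHF s₃ ≤ 50 / 720)) (g := g₁) (k := 3) (by norm_num) (by omega)
    have t₂ := div_nat_le_div_of_le hL₂ (hB₂.trans (by linarith : sigHF s₁ + sigHF s₃ ≤ 50 / 720)) (g := g₂) (k := 3) (by norm_num) (by omega)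
    have t₃ := div_nat_le_div_of_le hL₃ (hB₃.trans (by linarith : sigHF s₁ + sigHF s₂ ≤ 50 / 720)) (g := g₃) (k := 3) (by norm_num) (by omega)
    norm_num at t₁ t₂ t₃
    linarith
  rcases Nat.lt_or_ge (fE + zf) 1 with hf0 | hf1
  swap
  · -- `f = 1`, `Σ n ≥ 2`
    by_cases hbig : 2 ≤ a₁ + z₁ ∨ 2 ≤ a₂ + z₂ ∨ 2 ≤ a₃ + z₃
    · rcases hbig with h | h | h
      · have f₂ := sigHF_le_three (s := s₂) (by omega)
        have f₃ := sigHF_le_three (s := s₃) (by omega)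
        have t₁ := div_nat_le_div_of_le hL₁ (hB₁.trans (by linarith : sigHF s₂ + sigHF s₃ ≤ 10 / 720)) (g := g₁) (k := 4) (by norm_num) (by omega)
        have t₂ := div_nat_le_div_of_le hL₂ (hB₂.trans (by linarith : sigHF s₁ + sigHF s₃ ≤ 58 / 720)) (g := g₂) (k := 2) (by norm_num) (by omega)
        have t₃ := div_nat_le_div_of_le hL₃ (hB₃.trans (by linarith : sigHF s₁ + sigHF s₂ ≤ 58 / 720)) (g := g₃) (k := 2) (by norm_num) (by omega)
        exact key _ _ _ _ _ _ t₁ t₂ t₃ (by norm_num)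
      · have f₁ := sigHF_le_three (s := s₁) (by omega)
        have f₃ := sigHF_le_three (s := s₃) (by omega)
        have t₂ := div_nat_le_div_of_le hL₂ (hB₂.trans (by linarith : sigHF s₁ + sigHF s₃ ≤ 10 / 720)) (g := g₂) (k := 4) (by norm_num) (by omega)
        have t₁ := div_nat_le_div_of_le hL₁ (hB₁.trans (by linarith : sigHF s₂ + sigHF s₃ ≤ 58 / 720)) (g := g₁) (k := 2) (by norm_num) (by omega)
        have t₃ := div_nat_le_div_of_le hL₃ (hB₃.trans (by linarith : sigHF s₁ + sigHF s₂ ≤ 58 / 720)) (g := g₃) (k := 2) (by norm_num) (by omega)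
        exact key _ _ _ _ _ _ t₁ t₂ t₃ (by norm_num)
      · have f₁ := sigHF_le_three (s := s₁) (by omega)
        have f₂ := sigHF_le_three (s := s₂) (by omega)
        have t₃ := div_nat_le_div_of_le hL₃ (hB₃.trans (by linarith : sigHF s₁ + sigHF s₂ ≤ 10 / 720)) (g := g₃) (k := 4) (by norm_num) (by omega)
        have t₁ := div_nat_le_div_of_le hL₁ (hB₁.trans (by linarith : sigHF s₂ + sigHF s₃ ≤ 58 / 720)) (g := g₁) (k := 2) (by norm_num) (by omega)
        have t₂ := div_nat_le_div_of_le hL₂ (hB₂.trans (by linarith : sigHF s₁ + sigHF s₃ ≤ 58 / 720)) (g := g₂) (k := 2) (by norm_num) (by omega)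
        exact key _ _ _ _ _ _ t₁ t₂ t₃ (by norm_num)
    · push Not at hbig
      -- every `n ≤ 1`, two of them equal `1`
      by_cases h12 : a₁ + z₁ = 1 ∧ a₂ + z₂ = 1
      · have f₃ := sigHF_le_three (s := s₃) (by omega)
        have e₁ := sigHF_le_two (s := s₁) (by omega)
        have e₂ := sigHF_le_two (s := s₂) (by omega)
        have t₃ := div_nat_le_div_of_le hL₃ (hB₃.trans (by linarith : sigHF s₁ + sigHF s₂ ≤ 50 / 720)) (g := g₃) (k := 2) (by norm_num) (by omega)
        have t₁ := div_nat_le_div_of_le hL₁ (hB₁.trans (by linarith : sigHF s₂ + sigHF s₃ ≤ 30 / 720)) (g := g₁) (k := 3) (by norm_num) (by omega)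
        have t₂ := div_nat_le_div_of_le hL₂ (hB₂.trans (by linarith : sigHF s₁ + sigHF s₃ ≤ 30 / 720)) (g := g₂) (k := 3) (by norm_num) (by omega)
        exact key _ _ _ _ _ _ t₁ t₂ t₃ (by norm_num)
      · by_cases h13 : a₁ + z₁ = 1 ∧ a₃ + z₃ = 1
        · have f₂ := sigHF_le_three (s := s₂) (by omega)
          have e₁ := sigHF_le_two (s := s₁) (by omega)
          have e₃ := sigHF_le_two (s := s₃) (by omega)
          have t₂ := div_nat_le_div_of_le hL₂ (hB₂.trans (by linarith : sigHF s₁ + sigHF s₃ ≤ 50 / 720)) (g := g₂) (k := 2) (by norm_num) (by omega)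
          have t₁ := div_nat_le_div_of_le hL₁ (hB₁.trans (by linarith : sigHF s₂ + sigHF s₃ ≤ 30 / 720)) (g := g₁) (k := 3) (by norm_num) (by omega)
          have t₃ := div_nat_le_div_of_le hL₃ (hB₃.trans (by linarith : sigHF s₁ + sigHF s₂ ≤ 30 / 720)) (g := g₃) (k := 3) (by norm_num) (by omega)
          exact key _ _ _ _ _ _ t₁ t₂ t₃ (by norm_num)
        · have h23 : a₂ + z₂ = 1 ∧ a₃ + z₃ = 1 := by omega
          have f₁ := sigHF_le_three (s := s₁) (by omega)
          have e₂ := sigHF_le_two (s := s₂) (by omega)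
          have e₃ := sigHF_le_two (s := s₃) (by omega)
          have t₁ := div_nat_le_div_of_le hL₁ (hB₁.trans (by linarith : sigHF s₂ + sigHF s₃ ≤ 50 / 720)) (g := g₁) (k := 2) (by norm_num) (by omega)
          have t₂ := div_nat_le_div_of_le hL₂ (hB₂.trans (by linarith : sigHF s₁ + sigHF s₃ ≤ 30 / 720)) (g := g₂) (k := 3) (by norm_num) (by omega)
          have t₃ := div_nat_le_div_of_le hL₃ (hB₃.trans (by linarith : sigHF s₁ + sigHF s₂ ≤ 30 / 720)) (g := g₃) (k := 3) (by norm_num) (by omega)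
          exact key _ _ _ _ _ _ t₁ t₂ t₃ (by norm_num)
  · -- `f = 0`
    have hfE : fE = 0 := by omega
    have hzf : zf = 0 := by omega
    by_cases hnull : s₁ = 0 ∨ s₂ = 0 ∨ s₃ = 0
    · rcases hnull with h | h | h
      · rw [hn₂ (Or.inl h), hn₃ (Or.inl h), zero_div_nat, zero_div_nat]
        have f₂ := sigHF_le_three (s := s₂) (by omega)
        have f₃ := sigHF_le_three (s := s₃) (by omega)
        have t₁ := div_nat_le_div_of_le hL₁ (hB₁.trans (by linarith : sigHF s₂ + sigHF s₃ ≤ 10 / 720)) (g := g₁) (k := 4) (by norm_num) (by omega)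
        norm_num at t₁; linarith
      · rw [hn₁ (Or.inl h), hn₃ (Or.inr h), zero_div_nat, zero_div_nat]
        have f₁ := sigHF_le_three (s := s₁) (by omega)
        have f₃ := sigHF_le_three (s := s₃) (by omega)
        have t₂ := div_nat_le_div_of_le hL₂ (hB₂.trans (by linarith : sigHF s₁ + sigHF s₃ ≤ 10 / 720)) (g := g₂) (k := 4) (by norm_num) (by omega)
        norm_num at t₂; linarith
      · rw [hn₁ (Or.inr h), hn₂ (Or.inr h), zero_div_nat, zero_div_nat]
        have f₁ := sigHF_le_three (s := s₁) (by omega)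
        have f₂ := sigHF_le_three (s := s₂) (by omega)
        have t₃ := div_nat_le_div_of_le hL₃ (hB₃.trans (by linarith : sigHF s₁ + sigHF s₂ ≤ 10 / 720)) (g := g₃) (k := 4) (by norm_num) (by omega)
        norm_num at t₃; linarith
    · push Not at hnull
      rcases Nat.eq_zero_or_pos (a₁ + z₁) with h1 | h1
      · -- `n₁ = 0`, `n₂ + n₃ ≥ 3`: `s₁ ≥ 3`
        have f₁ := sigHF_le_three (s := s₁) (by omega)
        have t₁ := div_nat_le_div_of_le hL₁ (hB₁.trans (by linarith : sigHF s₂ + sigHF s₃ ≤ 106 / 720)) (g := g₁) (k := 2) (by norm_num) (by omega)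
        have t₂ := div_nat_le_div_of_le hL₂ (hB₂.trans (by linarith : sigHF s₁ + sigHF s₃ ≤ 58 / 720)) (g := g₂) (k := 2) (by norm_num) (by omega)
        have t₃ := div_nat_le_div_of_le hL₃ (hB₃.trans (by linarith : sigHF s₁ + sigHF s₂ ≤ 58 / 720)) (g := g₃) (k := 2) (by norm_num) (by omega)
        exact key _ _ _ _ _ _ t₁ t₂ t₃ (by norm_num)
      · rcases Nat.eq_zero_or_pos (a₂ + z₂) with h2 | h2
        · have f₂ := sigHF_le_three (s := s₂) (by omega)
          have t₂ := div_nat_le_div_of_le hL₂ (hB₂.trans (by linarith : sigHF s₁ + sigHF s₃ ≤ 106 / 720)) (g := g₂) (k := 2) (by norm_num) (by omega)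
          have t₁ := div_nat_le_div_of_le hL₁ (hB₁.trans (by linarith : sigHF s₂ + sigHF s₃ ≤ 58 / 720)) (g := g₁) (k := 2) (by norm_num) (by omega)
          have t₃ := div_nat_le_div_of_le hL₃ (hB₃.trans (by linarith : sigHF s₁ + sigHF s₂ ≤ 58 / 720)) (g := g₃) (k := 2) (by norm_num) (by omega)
          exact key _ _ _ _ _ _ t₁ t₂ t₃ (by norm_num)
        · rcases Nat.eq_zero_or_pos (a₃ + z₃) with h3 | h3
          · have f₃ := sigHF_le_three (s := s₃) (by omega)
            have t₃ := div_nat_le_div_of_le hL₃ (hB₃.trans (by linarith : sigHF s₁ + sigHF s₂ ≤ 106 / 720)) (g := g₃) (k := 2) (by norm_num) (by omega)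
            have t₁ := div_nat_le_div_of_le hL₁ (hB₁.trans (by linarith : sigHF s₂ + sigHF s₃ ≤ 58 / 720)) (g := g₁) (k := 2) (by norm_num) (by omega)
            have t₂ := div_nat_le_div_of_le hL₂ (hB₂.trans (by linarith : sigHF s₁ + sigHF s₃ ≤ 58 / 720)) (g := g₂) (k := 2) (by norm_num) (by omega)
            exact key _ _ _ _ _ _ t₁ t₂ t₃ (by norm_num)
          · have e₁ := sigHF_le_two (s := s₁) (by omega)
            have e₂ := sigHF_le_two (s := s₂) (by omega)
            have e₃ := sigHF_le_two (s := s₃) (by omega)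
            have t₁ := div_nat_le_div_of_le hL₁ (hB₁.trans (by linarith : sigHF s₂ + sigHF s₃ ≤ 50 / 720)) (g := g₁) (k := 2) (by norm_num) (by omega)
            have t₂ := div_nat_le_div_of_le hL₂ (hB₂.trans (by linarith : sigHF s₁ + sigHF s₃ ≤ 50 / 720)) (g := g₂) (k := 2) (by norm_num) (by omega)
            have t₃ := div_nat_le_div_of_le hL₃ (hB₃.trans (by linarith : sigHF s₁ + sigHF s₂ ≤ 50 / 720)) (g := g₃) (k := 2) (by norm_num) (by omega)
            exact key _ _ _ _ _ _ t₁ t₂ t₃ (by norm_num)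

end Side

end PercRepro.Shadow
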